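import Summits.CriticalPhenomena.PercolationContinuityZ3.Theorems.Transplant.FKConnectivityAllQAntipodalMaj3
import Summits.CriticalPhenomena.PercolationContinuityZ3.Theorems.Transplant.FKConnectivityAllQAntipodalAndGenPath
import HarnessLib

/-!
# Connectivity correlation inequalities for `φ_{w,q}`, every `q > 0` — file 34: **`C_∞` AT LEVEL 4 — THRESHOLD EVENTS ON ≤ 4 EDGES**
# (top cell) from the AND theorem (file 32c) and U¹¹ (gen 16), at an arbitrary position in the host

Support file (`--supports stmt-CriticalPhenomena-4575`), FK sub-lane `prim-bschramm-fk-2` (gen 19); builds on p205010 (kernel theorem, internal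
audit signed; external expert review pending).  No definitions, no named facts, no sorries; standard axioms.

With `D_A(g) := Σ_{γ ⊆ N} q^{k(γ∪A)+k(γᶜ∪(S∖A))}(g γ − g γᶜ)` (`A ⊆ S`, `N = H ∖ S`), `apPsi q H 1_𝒰 g = 2 Σ_{A ∈ 𝒰} D_A(g)` for every up-set `𝒰`
of `2^S`; an exact LP (memo `bschramm/FROM-fk-2-g19-JUNCTION-TRICHOTOMY.md` §11) shows that EVERY odd up-set type on `|S| ≤ 4` edges is a
nonnegative combination of the AND functionals `Σ_{A ⊇ T} D_A` (file 32c, `FK.apPsi_and_nonpos_of_isTTSP`) and the U¹¹ functionals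
`Σ_{A ∋ a, |A ∩ {b,c}| = 1} D_A` (gen 16, `FK.apPsi_edge_split_nonpos_of_isTTSP`), so `C_∞` holds at the top cell whenever
`min(|supp f|, |supp g|) ≤ 4`.  This file types the ingredients at an ARBITRARY position of the host `H = E ∪ {st}` (re-rooting by
`FK.IsTTSP.reroot_erase`) and the most natural level-4 instances, the THRESHOLD events:
* `FK.apPsi_andSet_nonpos_of_isTTSP` — AND of any nonempty `S ⊆ H`;  `FK.apPsi_orSet_nonpos_of_isTTSP` — OR of `S` (same odd part);
* `FK.apPsi_pivot_nonpos_of_isTTSP`, `FK.apPsi_pivot_split_nonpos_of_isTTSP` — Theorem U and U¹¹ with the pivot at any edge of `H`;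
* `FK.apPsi_maj3Set_nonpos_of_isTTSP` — gen 17's majority theorem at any three edges of `H`;
* `FK.apPsi_thr3of4_eq` — the level-4 identity `F_{≥3 of 4} = ½(F_z·split_{xy} + F_w·split_{xy} + F_x·split_{zw} + F_y·split_{zw}) + F_{and₄}`
  (= `MS(∅;S;3) + AND_S`, memo §11), `FK.apPsi_thr2of4_eq_thr3of4` (`≥ 2 of 4` is the dual type: same odd part);
* **`FK.apPsi_thr3of4_nonpos_of_isTTSP`**, **`FK.apPsi_thr2of4_nonpos_of_isTTSP`** — with AND (`= 4 of 4`) and OR (`≥ 1 of 4`): EVERY threshold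
  event `{at least j of the 4 edges x,y,z,w are open}` of a 2-connected series–parallel graph is, coefficientwise at the top cell, negatively
  correlated with every increasing `g` off `{x,y,z,w}` (`0 < q ≤ 1`);
* `FK.apPsi_andOr3_nonpos_of_isTTSP` — the type `x ∧ (y ∨ z ∨ w)` (`= ½U_x + ¼(U¹¹_{x;zw}+U¹¹_{x;yz}+U¹¹_{x;yw}) + ½AND_{yzw}`), a genuinely
  level-4 row of the certificate table.
[cite: Grimmett2006, §1.4 eq. (1.20) (p. 15); §3.8 Thm. (3.90) (pp. 61–62); §3.9 (pp. 63–64)] [cite: Wagner2006, Thm. 5.8(d), §5.3]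
-/

noncomputable section

namespace Summit.CriticalPhenomena.PercolationContinuityZ3.Theorems

namespace FK

open Literature.Probability.LatticeModels Literature.Probability.Percolation
open scoped Classical

variable {V : Type*} [Fintype V] {s t : V}

/-! ### Re-rooting: AND, OR, U, U¹¹, maj₃ at an arbitrary position of the host -/

section Reroot

omit [Fintype V] in
/-- A function not reading the edges of `S` is invariant under adjoining any subset of `S`. [folklore] -/
theorem notRead_union {g : Finset (Sym2 V) → ℝ} {S : Finset (Sym2 V)} (hg : ∀ e ∈ S, ∀ A : Finset (Sym2 V), g (insert e A) = g A) :
    ∀ U : Finset (Sym2 V), U ⊆ S → ∀ A : Finset (Sym2 V), g (A ∪ U) = g A := by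
  intro U
  induction U using Finset.induction_on with
  | empty => intro _ A; rw [Finset.union_empty]
  | @insert e U _ ih =>
    intro hU A
    rw [Finset.union_insert, hg e (hU (Finset.mem_insert_self _ _)), ih (fun f hf => hU (Finset.mem_insert_of_mem hf))]

omit [Fintype V] in
/-- The host `E ∪ {st}` of a two-terminal series–parallel `E ∌ st` is not a single edge. [folklore] -/
theorem insert_ne_singleton_of_isTTSP {E : Finset (Sym2 V)} (hE : IsTTSP E s t) (hst : s(s, t) ∉ E) (a : Sym2 V) :
    insert s(s, t) E ≠ {a} := by
  intro hh
  obtain ⟨f, hf, _⟩ := hE.left_mem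
  have hf' : f ∈ ({a} : Finset (Sym2 V)) := hh ▸ Finset.mem_insert_of_mem hf
  have hs' : s(s, t) ∈ ({a} : Finset (Sym2 V)) := hh ▸ Finset.mem_insert_self _ _
  rw [Finset.mem_singleton] at hf' hs'
  exact hst (hs' ▸ hf' ▸ hf)

/-- **AND of any nonempty edge set (top cell).**  `E` TTSP between `s, t`, `st ∉ E`, `∅ ≠ S ⊆ H = E ∪ {st}`, `0 < q ≤ 1`, `g` monotone on
the sub-configurations of `H` and not reading `S` ⟹ `apPsi q H 1_{S ⊆ ·} g ≤ 0` — file 32c's theorem after re-rooting `H` at an edge of `S`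
(`FK.IsTTSP.reroot_erase`). [cite: Grimmett2006, §3.8 Thm. (3.90) (pp. 61–62); §3.9 (pp. 63–64)] -/
theorem apPsi_andSet_nonpos_of_isTTSP {q : ℝ} (hq0 : 0 < q) (hq1 : q ≤ 1) {E : Finset (Sym2 V)} (hE : IsTTSP E s t)
    (hst : s(s, t) ∉ E) {S : Finset (Sym2 V)} (hS : S ⊆ insert s(s, t) E) (hSne : S.Nonempty)
    {g : Finset (Sym2 V) → ℝ} (hg : ∀ e ∈ S, ∀ A : Finset (Sym2 V), g (insert e A) = g A)
    (hmono : ∀ ⦃X Y : Finset (Sym2 V)⦄, X ⊆ Y → Y ⊆ insert s(s, t) E → g X ≤ g Y) :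
    apPsi q (insert s(s, t) E) (fun X => if S ⊆ X then 1 else 0) g ≤ 0 := by
  obtain ⟨a, ha⟩ := hSne
  induction a using Sym2.ind with
  | h a₁ a₂ =>
    have haH : s(a₁, a₂) ∈ insert s(s, t) E := hS ha
    have hE' := hE.reroot_erase haH (insert_ne_singleton_of_isTTSP hE hst _)
    have hH : insert s(a₁, a₂) ((insert s(s, t) E).erase s(a₁, a₂)) = insert s(s, t) E := Finset.insert_erase haH
    have hT : S.erase s(a₁, a₂) ⊆ (insert s(s, t) E).erase s(a₁, a₂) := fun e he =>
      Finset.mem_erase.2 ⟨(Finset.mem_erase.1 he).1, hS (Finset.mem_of_mem_erase he)⟩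
    have hSeq : insert s(a₁, a₂) (S.erase s(a₁, a₂)) = S := Finset.insert_erase ha
    have hHeq : ((insert s(s, t) E).erase s(a₁, a₂) \ S.erase s(a₁, a₂)) ∪ insert s(a₁, a₂) (S.erase s(a₁, a₂)) =
        insert s(s, t) E := by
      rw [Finset.union_insert, Finset.sdiff_union_of_subset hT, hH]
    have key := apPsi_and_nonpos_of_isTTSP hq0 hq1 hE' (Finset.notMem_erase _ _) Finset.sdiff_subset hT Finset.sdiff_disjoint
      (g := g) (fun A U hU => notRead_union hg U (fun e he => hSeq ▸ hU he) A)
      (fun X Y hXY hY => hmono hXY (hY.trans (Finset.sdiff_subset.trans (Finset.erase_subset _ _))))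
    rw [hHeq, hSeq] at key
    exact key

omit [Fintype V] in
/-- **OR and AND have the same odd part**: for `S ⊆ H`, `1{S ∩ γ ≠ ∅} − 1{S ∩ (H∖γ) ≠ ∅} = 1{S ⊆ γ} − 1{S ⊆ H∖γ}` for every `γ ⊆ H`, so
`apPsi q H 1_{OR S} g = apPsi q H 1_{AND S} g`. [folklore] -/
theorem apPsi_orSet_eq_andSet (q : ℝ) {H S : Finset (Sym2 V)} (hS : S ⊆ H) (g : Finset (Sym2 V) → ℝ) :
    apPsi q H (fun X => if ∃ e ∈ S, e ∈ X then 1 else 0) g = apPsi q H (fun X => if S ⊆ X then 1 else 0) g := by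
  unfold apPsi
  refine Finset.sum_congr rfl fun γ _ => ?_
  have i1 : (∃ e ∈ S, e ∈ H \ γ) ↔ ¬ S ⊆ γ := by
    rw [Finset.not_subset]
    exact ⟨fun ⟨e, he, h⟩ => ⟨e, he, (Finset.mem_sdiff.1 h).2⟩, fun ⟨e, he, h⟩ => ⟨e, he, Finset.mem_sdiff.2 ⟨hS he, h⟩⟩⟩
  have i2 : (∃ e ∈ S, e ∈ γ) ↔ ¬ S ⊆ H \ γ := by
    rw [Finset.not_subset]
    refine ⟨fun ⟨e, he, h⟩ => ⟨e, he, fun h' => (Finset.mem_sdiff.1 h').2 h⟩, fun ⟨e, he, h⟩ => ⟨e, he, ?_⟩⟩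
    by_contra hn
    exact h (Finset.mem_sdiff.2 ⟨hS he, hn⟩)
  dsimp only
  rw [show ((if ∃ e ∈ S, e ∈ γ then (1 : ℝ) else 0) - if ∃ e ∈ S, e ∈ H \ γ then (1 : ℝ) else 0) =
      (if S ⊆ γ then (1 : ℝ) else 0) - if S ⊆ H \ γ then (1 : ℝ) else 0 by
    simp only [i1, i2]
    by_cases p : S ⊆ γ <;> by_cases r : S ⊆ H \ γ <;> simp only [p, r, not_true_eq_false, not_false_eq_true, if_true, if_false] <;> ring]

/-- **OR of any nonempty edge set (top cell)** — by `FK.apPsi_orSet_eq_andSet` and `FK.apPsi_andSet_nonpos_of_isTTSP`.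
[cite: Grimmett2006, §3.8 Thm. (3.90) (pp. 61–62); §3.9 (pp. 63–64)] -/
theorem apPsi_orSet_nonpos_of_isTTSP {q : ℝ} (hq0 : 0 < q) (hq1 : q ≤ 1) {E : Finset (Sym2 V)} (hE : IsTTSP E s t)
    (hst : s(s, t) ∉ E) {S : Finset (Sym2 V)} (hS : S ⊆ insert s(s, t) E) (hSne : S.Nonempty)
    {g : Finset (Sym2 V) → ℝ} (hg : ∀ e ∈ S, ∀ A : Finset (Sym2 V), g (insert e A) = g A)
    (hmono : ∀ ⦃X Y : Finset (Sym2 V)⦄, X ⊆ Y → Y ⊆ insert s(s, t) E → g X ≤ g Y) :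
    apPsi q (insert s(s, t) E) (fun X => if ∃ e ∈ S, e ∈ X then 1 else 0) g ≤ 0 := by
  rw [apPsi_orSet_eq_andSet q hS]
  exact apPsi_andSet_nonpos_of_isTTSP hq0 hq1 hE hst hS hSne hg hmono

/-- **Theorem U with the pivot at any edge of the host** (`0 < q ≤ 1`): `a ∈ H = E ∪ {st}`, `g` monotone on the sub-configurations of `H`
not reading `a` ⟹ `apPsi q H 1_a g ≤ 0` (gen 11's theorem after re-rooting at `a`). [cite: Grimmett2006, §3.9 (pp. 63–64)] -/
theorem apPsi_pivot_nonpos_of_isTTSP {q : ℝ} (hq0 : 0 < q) (hq1 : q ≤ 1) {E : Finset (Sym2 V)} (hE : IsTTSP E s t)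
    (hst : s(s, t) ∉ E) {a : Sym2 V} (ha : a ∈ insert s(s, t) E) {g : Finset (Sym2 V) → ℝ}
    (hga : ∀ A : Finset (Sym2 V), g (insert a A) = g A)
    (hmono : ∀ ⦃A B : Finset (Sym2 V)⦄, A ⊆ B → B ⊆ insert s(s, t) E → g A ≤ g B) :
    apPsi q (insert s(s, t) E) (fun A => if a ∈ A then 1 else 0) g ≤ 0 := by
  have h := apPsi_andSet_nonpos_of_isTTSP hq0 hq1 hE hst (Finset.singleton_subset_iff.2 ha) (Finset.singleton_nonempty a)
    (fun e he A => by rw [Finset.mem_singleton.1 he]; exact hga A) hmono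
  have hfun : (fun X : Finset (Sym2 V) => if ({a} : Finset (Sym2 V)) ⊆ X then (1 : ℝ) else 0) =
      fun X => if a ∈ X then (1 : ℝ) else 0 := by
    funext X; simp only [Finset.singleton_subset_iff]
  rw [hfun] at h
  exact h

/-- **U¹¹ with the pivot at any edge of the host** (`0 < q ≤ 1`): `a, b, c ∈ H = E ∪ {st}` distinct, `g` monotone on the sub-configurations
of `H` reading none of `a, b, c` ⟹ `apPsi q H 1_a (split_{bc} · g) ≤ 0` (gen 16's theorem `FK.apPsi_edge_split_nonpos_of_isTTSP` after
re-rooting at `a`). [cite: Grimmett2006, §3.8 Thm. (3.90) (pp. 61–62); §3.9 (pp. 63–64)] -/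
theorem apPsi_pivot_split_nonpos_of_isTTSP {q : ℝ} (hq0 : 0 < q) (hq1 : q ≤ 1) {E : Finset (Sym2 V)} (hE : IsTTSP E s t)
    (hst : s(s, t) ∉ E) {a b c : Sym2 V} (ha : a ∈ insert s(s, t) E) (hb : b ∈ insert s(s, t) E) (hc : c ∈ insert s(s, t) E)
    (hab : a ≠ b) (hac : a ≠ c) (hbc : b ≠ c) {g : Finset (Sym2 V) → ℝ}
    (hga : ∀ A : Finset (Sym2 V), g (insert a A) = g A) (hgb : ∀ A : Finset (Sym2 V), g (insert b A) = g A)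
    (hgc : ∀ A : Finset (Sym2 V), g (insert c A) = g A)
    (hmono : ∀ ⦃A B : Finset (Sym2 V)⦄, A ⊆ B → B ⊆ insert s(s, t) E → g A ≤ g B) :
    apPsi q (insert s(s, t) E) (fun A => if a ∈ A then 1 else 0) (fun A => splitInd b c A * g A) ≤ 0 := by
  induction a using Sym2.ind with
  | h a₁ a₂ =>
    have hE' := hE.reroot_erase ha (insert_ne_singleton_of_isTTSP hE hst _)
    have hH : insert s(a₁, a₂) ((insert s(s, t) E).erase s(a₁, a₂)) = insert s(s, t) E := Finset.insert_erase ha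
    rw [← hH]
    exact apPsi_edge_split_nonpos_of_isTTSP hq0 hq1 hE' (Finset.notMem_erase _ _) (Finset.mem_erase.2 ⟨hab.symm, hb⟩)
      (Finset.mem_erase.2 ⟨hac.symm, hc⟩) hbc hga hgb hgc fun A B hAB hB => hmono hAB (hB.trans (Finset.erase_subset _ _))

/-- **The majority of any three edges of the host** (`0 < q ≤ 1`): `x, y, z ∈ H` distinct, `g` monotone on the sub-configurations of `H`
reading none of them ⟹ `apPsi q H maj(1_x,1_y,1_z) g ≤ 0` (gen 17's `FK.apPsi_maj3_nonpos_of_isTTSP` after re-rooting at `x`).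
[cite: Grimmett2006, §3.8 Thm. (3.90) (pp. 61–62); §3.9 (pp. 63–64)] -/
theorem apPsi_maj3Set_nonpos_of_isTTSP {q : ℝ} (hq0 : 0 < q) (hq1 : q ≤ 1) {E : Finset (Sym2 V)} (hE : IsTTSP E s t)
    (hst : s(s, t) ∉ E) {x y z : Sym2 V} (hx : x ∈ insert s(s, t) E) (hy : y ∈ insert s(s, t) E) (hz : z ∈ insert s(s, t) E)
    (hxy : x ≠ y) (hxz : x ≠ z) (hyz : y ≠ z) {g : Finset (Sym2 V) → ℝ}
    (hgx : ∀ A : Finset (Sym2 V), g (insert x A) = g A) (hgy : ∀ A : Finset (Sym2 V), g (insert y A) = g A)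
    (hgz : ∀ A : Finset (Sym2 V), g (insert z A) = g A)
    (hmono : ∀ ⦃A B : Finset (Sym2 V)⦄, A ⊆ B → B ⊆ insert s(s, t) E → g A ≤ g B) :
    apPsi q (insert s(s, t) E) (fun A => if (x ∈ A ∧ y ∈ A) ∨ (x ∈ A ∧ z ∈ A) ∨ (y ∈ A ∧ z ∈ A) then 1 else 0) g ≤ 0 := by
  induction x using Sym2.ind with
  | h x₁ x₂ =>
    have hE' := hE.reroot_erase hx (insert_ne_singleton_of_isTTSP hE hst _)
    have hH : insert s(x₁, x₂) ((insert s(s, t) E).erase s(x₁, x₂)) = insert s(s, t) E := Finset.insert_erase hx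
    rw [← hH]
    exact apPsi_maj3_nonpos_of_isTTSP hq0 hq1 hE' (Finset.notMem_erase _ _) (Finset.mem_erase.2 ⟨hxy.symm, hy⟩)
      (Finset.mem_erase.2 ⟨hxz.symm, hz⟩) hyz hgx hgy hgz fun A B hAB hB => hmono hAB (by rwa [hH] at hB)

end Reroot

/-! ### Level 4: the threshold events on four edges -/

section Threshold

omit [Fintype V] in
/-- **The level-4 identity**: for `x, y, z, w ∈ H` and any `g`,
`apPsi q H 1{≥ 3 of x,y,z,w} g = ½(apPsi q H 1_z (split_{xy}·g) + apPsi q H 1_w (split_{xy}·g) + apPsi q H 1_x (split_{zw}·g)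
+ apPsi q H 1_y (split_{zw}·g)) + apPsi q H 1{x,y,z,w all} g` — the pointwise identity of odd increments
`F_{≥3} = ½(F_z + F_w)·split_{xy} + ½(F_x + F_y)·split_{zw} + F_{and₄}` on the sixteen patterns `γ ∩ {x,y,z,w}` (memo g19 §11:
`thr₃ = MS(∅;S;3) + AND_S`, `MS(∅;S;3) = ½ Σ U¹¹`). [folklore] -/
theorem apPsi_thr3of4_eq (q : ℝ) {H : Finset (Sym2 V)} {x y z w : Sym2 V} (hx : x ∈ H) (hy : y ∈ H) (hz : z ∈ H) (hw : w ∈ H)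
    (g : Finset (Sym2 V) → ℝ) :
    apPsi q H (fun A => if (x ∈ A ∧ y ∈ A ∧ z ∈ A) ∨ (x ∈ A ∧ y ∈ A ∧ w ∈ A) ∨ (x ∈ A ∧ z ∈ A ∧ w ∈ A) ∨
        (y ∈ A ∧ z ∈ A ∧ w ∈ A) then 1 else 0) g =
      (apPsi q H (fun A => if z ∈ A then 1 else 0) (fun A => splitInd x y A * g A) +
          apPsi q H (fun A => if w ∈ A then 1 else 0) (fun A => splitInd x y A * g A) +
          apPsi q H (fun A => if x ∈ A then 1 else 0) (fun A => splitInd z w A * g A) +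
          apPsi q H (fun A => if y ∈ A then 1 else 0) (fun A => splitInd z w A * g A)) / 2 +
        apPsi q H (fun A => if x ∈ A ∧ y ∈ A ∧ z ∈ A ∧ w ∈ A then 1 else 0) g := by
  unfold apPsi
  rw [← Finset.sum_add_distrib, ← Finset.sum_add_distrib, ← Finset.sum_add_distrib, Finset.sum_div, ← Finset.sum_add_distrib]
  refine Finset.sum_congr rfl fun γ _ => ?_
  have hxc : x ∈ H \ γ ↔ x ∉ γ := by rw [Finset.mem_sdiff]; exact ⟨fun h => h.2, fun h => ⟨hx, h⟩⟩
  have hyc : y ∈ H \ γ ↔ y ∉ γ := by rw [Finset.mem_sdiff]; exact ⟨fun h => h.2, fun h => ⟨hy, h⟩⟩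
  have hzc : z ∈ H \ γ ↔ z ∉ γ := by rw [Finset.mem_sdiff]; exact ⟨fun h => h.2, fun h => ⟨hz, h⟩⟩
  have hwc : w ∈ H \ γ ↔ w ∉ γ := by rw [Finset.mem_sdiff]; exact ⟨fun h => h.2, fun h => ⟨hw, h⟩⟩
  dsimp only
  rw [TwoSpine.splitInd_compl hx hy, TwoSpine.splitInd_compl hz hw]
  unfold splitInd
  simp only [hxc, hyc, hzc, hwc]
  by_cases a : x ∈ γ <;> by_cases b : y ∈ γ <;> by_cases c : z ∈ γ <;> by_cases d : w ∈ γ <;>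
  simp only [a, b, c, d, and_self, and_true, and_false, or_self, or_true, or_false,
    if_true, if_false, not_true_eq_false, not_false_eq_true, iff_true, iff_false] <;> ring

omit [Fintype V] in
/-- **`≥ 2 of 4` is the dual type of `≥ 3 of 4`**: the two threshold indicators have the same odd increments on complementary pairs inside
`H`, hence the same `apPsi` against every `g`. [folklore] -/
theorem apPsi_thr2of4_eq_thr3of4 (q : ℝ) {H : Finset (Sym2 V)} {x y z w : Sym2 V} (hx : x ∈ H) (hy : y ∈ H) (hz : z ∈ H)
    (hw : w ∈ H) (g : Finset (Sym2 V) → ℝ) :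
    apPsi q H (fun A => if (x ∈ A ∧ y ∈ A) ∨ (x ∈ A ∧ z ∈ A) ∨ (x ∈ A ∧ w ∈ A) ∨ (y ∈ A ∧ z ∈ A) ∨ (y ∈ A ∧ w ∈ A) ∨
        (z ∈ A ∧ w ∈ A) then 1 else 0) g =
      apPsi q H (fun A => if (x ∈ A ∧ y ∈ A ∧ z ∈ A) ∨ (x ∈ A ∧ y ∈ A ∧ w ∈ A) ∨ (x ∈ A ∧ z ∈ A ∧ w ∈ A) ∨
        (y ∈ A ∧ z ∈ A ∧ w ∈ A) then 1 else 0) g := by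
  unfold apPsi
  refine Finset.sum_congr rfl fun γ _ => ?_
  have hxc : x ∈ H \ γ ↔ x ∉ γ := by rw [Finset.mem_sdiff]; exact ⟨fun h => h.2, fun h => ⟨hx, h⟩⟩
  have hyc : y ∈ H \ γ ↔ y ∉ γ := by rw [Finset.mem_sdiff]; exact ⟨fun h => h.2, fun h => ⟨hy, h⟩⟩
  have hzc : z ∈ H \ γ ↔ z ∉ γ := by rw [Finset.mem_sdiff]; exact ⟨fun h => h.2, fun h => ⟨hz, h⟩⟩
  have hwc : w ∈ H \ γ ↔ w ∉ γ := by rw [Finset.mem_sdiff]; exact ⟨fun h => h.2, fun h => ⟨hw, h⟩⟩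
  dsimp only
  simp only [hxc, hyc, hzc, hwc]
  by_cases a : x ∈ γ <;> by_cases b : y ∈ γ <;> by_cases c : z ∈ γ <;> by_cases d : w ∈ γ <;>
  simp only [a, b, c, d, and_self, and_true, and_false, or_self, or_true, or_false,
    if_true, if_false, not_true_eq_false, not_false_eq_true] <;> ring

/-- **`C_∞` FOR THE THRESHOLD `≥ 3 OF 4` (`0 < q ≤ 1`, top cell).**  `E` two-terminal series–parallel between `s, t`, `st ∉ E`,
`x, y, z, w ∈ H = E ∪ {st}` distinct, `g` monotone on the sub-configurations of `H` reading none of them ⟹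
`apPsi q H 1{≥ 3 of x,y,z,w} g ≤ 0`: every square-free top coefficient of `Z_H² Cov_{φ_{z,q}}(1{≥ 3 of 4 open}, g)` is `≤ 0`.
Proof: `FK.apPsi_thr3of4_eq` + U¹¹ at the four pivots (`FK.apPsi_pivot_split_nonpos_of_isTTSP`) + the AND theorem
(`FK.apPsi_andSet_nonpos_of_isTTSP`). [cite: Grimmett2006, §3.8 Thm. (3.90) (pp. 61–62); §3.9 (pp. 63–64)] [cite: Wagner2006, Thm. 5.8(d), §5.3] -/
theorem apPsi_thr3of4_nonpos_of_isTTSP {q : ℝ} (hq0 : 0 < q) (hq1 : q ≤ 1) {E : Finset (Sym2 V)} (hE : IsTTSP E s t)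
    (hst : s(s, t) ∉ E) {x y z w : Sym2 V} (hx : x ∈ insert s(s, t) E) (hy : y ∈ insert s(s, t) E)
    (hz : z ∈ insert s(s, t) E) (hw : w ∈ insert s(s, t) E) (hxy : x ≠ y) (hxz : x ≠ z) (hxw : x ≠ w) (hyz : y ≠ z)
    (hyw : y ≠ w) (hzw : z ≠ w) {g : Finset (Sym2 V) → ℝ}
    (hgx : ∀ A : Finset (Sym2 V), g (insert x A) = g A) (hgy : ∀ A : Finset (Sym2 V), g (insert y A) = g A)
    (hgz : ∀ A : Finset (Sym2 V), g (insert z A) = g A) (hgw : ∀ A : Finset (Sym2 V), g (insert w A) = g A)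
    (hmono : ∀ ⦃A B : Finset (Sym2 V)⦄, A ⊆ B → B ⊆ insert s(s, t) E → g A ≤ g B) :
    apPsi q (insert s(s, t) E) (fun A => if (x ∈ A ∧ y ∈ A ∧ z ∈ A) ∨ (x ∈ A ∧ y ∈ A ∧ w ∈ A) ∨ (x ∈ A ∧ z ∈ A ∧ w ∈ A) ∨
        (y ∈ A ∧ z ∈ A ∧ w ∈ A) then 1 else 0) g ≤ 0 := by
  rw [apPsi_thr3of4_eq q hx hy hz hw]
  have h1 := apPsi_pivot_split_nonpos_of_isTTSP hq0 hq1 hE hst hz hx hy hxz.symm hyz.symm hxy hgz hgx hgy hmono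
  have h2 := apPsi_pivot_split_nonpos_of_isTTSP hq0 hq1 hE hst hw hx hy hxw.symm hyw.symm hxy hgw hgx hgy hmono
  have h3 := apPsi_pivot_split_nonpos_of_isTTSP hq0 hq1 hE hst hx hz hw hxz hxw hzw hgx hgz hgw hmono
  have h4 := apPsi_pivot_split_nonpos_of_isTTSP hq0 hq1 hE hst hy hz hw hyz hyw hzw hgy hgz hgw hmono
  have hS : ({x, y, z, w} : Finset (Sym2 V)) ⊆ insert s(s, t) E := by
    intro e he
    simp only [Finset.mem_insert, Finset.mem_singleton] at he
    rcases he with rfl | rfl | rfl | rfl <;> assumption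
  have h5 := apPsi_andSet_nonpos_of_isTTSP hq0 hq1 hE hst hS ⟨x, by simp⟩ (fun e he A => by
    simp only [Finset.mem_insert, Finset.mem_singleton] at he
    rcases he with rfl | rfl | rfl | rfl
    · exact hgx A
    · exact hgy A
    · exact hgz A
    · exact hgw A) hmono
  have hfun : (fun X : Finset (Sym2 V) => if ({x, y, z, w} : Finset (Sym2 V)) ⊆ X then (1 : ℝ) else 0) =
      fun A => if x ∈ A ∧ y ∈ A ∧ z ∈ A ∧ w ∈ A then (1 : ℝ) else 0 := by
    funext X; simp only [Finset.insert_subset_iff, Finset.singleton_subset_iff]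
  rw [hfun] at h5
  linarith

/-- **`C_∞` FOR THE THRESHOLD `≥ 2 OF 4` (`0 < q ≤ 1`, top cell)** — the dual type, by `FK.apPsi_thr2of4_eq_thr3of4`.  Together with
`FK.apPsi_orSet_nonpos_of_isTTSP` (`≥ 1`) and `FK.apPsi_andSet_nonpos_of_isTTSP` (`= 4`): every threshold event on four edges of a
2-connected series–parallel graph is coefficientwise (top cell) negatively correlated with every increasing event off those edges.
[cite: Grimmett2006, §3.8 Thm. (3.90) (pp. 61–62); §3.9 (pp. 63–64)] [cite: Wagner2006, Thm. 5.8(d), §5.3] -/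
theorem apPsi_thr2of4_nonpos_of_isTTSP {q : ℝ} (hq0 : 0 < q) (hq1 : q ≤ 1) {E : Finset (Sym2 V)} (hE : IsTTSP E s t)
    (hst : s(s, t) ∉ E) {x y z w : Sym2 V} (hx : x ∈ insert s(s, t) E) (hy : y ∈ insert s(s, t) E)
    (hz : z ∈ insert s(s, t) E) (hw : w ∈ insert s(s, t) E) (hxy : x ≠ y) (hxz : x ≠ z) (hxw : x ≠ w) (hyz : y ≠ z)
    (hyw : y ≠ w) (hzw : z ≠ w) {g : Finset (Sym2 V) → ℝ}
    (hgx : ∀ A : Finset (Sym2 V), g (insert x A) = g A) (hgy : ∀ A : Finset (Sym2 V), g (insert y A) = g A)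
    (hgz : ∀ A : Finset (Sym2 V), g (insert z A) = g A) (hgw : ∀ A : Finset (Sym2 V), g (insert w A) = g A)
    (hmono : ∀ ⦃A B : Finset (Sym2 V)⦄, A ⊆ B → B ⊆ insert s(s, t) E → g A ≤ g B) :
    apPsi q (insert s(s, t) E) (fun A => if (x ∈ A ∧ y ∈ A) ∨ (x ∈ A ∧ z ∈ A) ∨ (x ∈ A ∧ w ∈ A) ∨ (y ∈ A ∧ z ∈ A) ∨
        (y ∈ A ∧ w ∈ A) ∨ (z ∈ A ∧ w ∈ A) then 1 else 0) g ≤ 0 := by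
  rw [apPsi_thr2of4_eq_thr3of4 q hx hy hz hw]
  exact apPsi_thr3of4_nonpos_of_isTTSP hq0 hq1 hE hst hx hy hz hw hxy hxz hxw hyz hyw hzw hgx hgy hgz hgw hmono

omit [Fintype V] in
/-- **The AND–OR type decomposes**: for `x, y, z, w ∈ H`,
`apPsi q H 1{x ∧ (y ∨ z ∨ w)} g = ½ apPsi q H 1_x g + ¼(apPsi q H 1_x (split_{zw}·g) + apPsi q H 1_x (split_{yz}·g) + apPsi q H 1_x (split_{yw}·g))
+ ½ apPsi q H 1{y,z,w all} g` (memo g19 §11, row `U = min[xw,xy,xz]`: `½AND_x + ¼(U¹¹_{x;zw}+U¹¹_{x;yz}+U¹¹_{x;yw}) + ½AND_{yzw}`). [folklore] -/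
theorem apPsi_andOr3_eq (q : ℝ) {H : Finset (Sym2 V)} {x y z w : Sym2 V} (hx : x ∈ H) (hy : y ∈ H) (hz : z ∈ H) (hw : w ∈ H)
    (g : Finset (Sym2 V) → ℝ) :
    apPsi q H (fun A => if x ∈ A ∧ (y ∈ A ∨ z ∈ A ∨ w ∈ A) then 1 else 0) g =
      apPsi q H (fun A => if x ∈ A then 1 else 0) g / 2 +
        (apPsi q H (fun A => if x ∈ A then 1 else 0) (fun A => splitInd z w A * g A) +
          apPsi q H (fun A => if x ∈ A then 1 else 0) (fun A => splitInd y z A * g A) +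
          apPsi q H (fun A => if x ∈ A then 1 else 0) (fun A => splitInd y w A * g A)) / 4 +
        apPsi q H (fun A => if y ∈ A ∧ z ∈ A ∧ w ∈ A then 1 else 0) g / 2 := by
  unfold apPsi
  rw [← Finset.sum_add_distrib, ← Finset.sum_add_distrib, Finset.sum_div, Finset.sum_div, Finset.sum_div,
    ← Finset.sum_add_distrib, ← Finset.sum_add_distrib]
  refine Finset.sum_congr rfl fun γ _ => ?_
  have hxc : x ∈ H \ γ ↔ x ∉ γ := by rw [Finset.mem_sdiff]; exact ⟨fun h => h.2, fun h => ⟨hx, h⟩⟩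
  have hyc : y ∈ H \ γ ↔ y ∉ γ := by rw [Finset.mem_sdiff]; exact ⟨fun h => h.2, fun h => ⟨hy, h⟩⟩
  have hzc : z ∈ H \ γ ↔ z ∉ γ := by rw [Finset.mem_sdiff]; exact ⟨fun h => h.2, fun h => ⟨hz, h⟩⟩
  have hwc : w ∈ H \ γ ↔ w ∉ γ := by rw [Finset.mem_sdiff]; exact ⟨fun h => h.2, fun h => ⟨hw, h⟩⟩
  dsimp only
  rw [TwoSpine.splitInd_compl hz hw, TwoSpine.splitInd_compl hy hz, TwoSpine.splitInd_compl hy hw]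
  unfold splitInd
  simp only [hxc, hyc, hzc, hwc]
  by_cases a : x ∈ γ <;> by_cases b : y ∈ γ <;> by_cases c : z ∈ γ <;> by_cases d : w ∈ γ <;>
  simp only [a, b, c, d, and_self, and_true, and_false, or_self, or_true, or_false,
    if_true, if_false, not_true_eq_false, not_false_eq_true, iff_true, iff_false] <;> ring

/-- **`C_∞` FOR THE TYPE `x ∧ (y ∨ z ∨ w)` (`0 < q ≤ 1`, top cell)** — a genuinely level-4 row of the certificate table: Theorem U at `x`,
U¹¹ at `x` against the three pairs, and the AND theorem for `{y,z,w}`.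
[cite: Grimmett2006, §3.8 Thm. (3.90) (pp. 61–62); §3.9 (pp. 63–64)] [cite: Wagner2006, Thm. 5.8(d), §5.3] -/
theorem apPsi_andOr3_nonpos_of_isTTSP {q : ℝ} (hq0 : 0 < q) (hq1 : q ≤ 1) {E : Finset (Sym2 V)} (hE : IsTTSP E s t)
    (hst : s(s, t) ∉ E) {x y z w : Sym2 V} (hx : x ∈ insert s(s, t) E) (hy : y ∈ insert s(s, t) E)
    (hz : z ∈ insert s(s, t) E) (hw : w ∈ insert s(s, t) E) (hxy : x ≠ y) (hxz : x ≠ z) (hxw : x ≠ w) (hyz : y ≠ z)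
    (hyw : y ≠ w) (hzw : z ≠ w) {g : Finset (Sym2 V) → ℝ}
    (hgx : ∀ A : Finset (Sym2 V), g (insert x A) = g A) (hgy : ∀ A : Finset (Sym2 V), g (insert y A) = g A)
    (hgz : ∀ A : Finset (Sym2 V), g (insert z A) = g A) (hgw : ∀ A : Finset (Sym2 V), g (insert w A) = g A)
    (hmono : ∀ ⦃A B : Finset (Sym2 V)⦄, A ⊆ B → B ⊆ insert s(s, t) E → g A ≤ g B) :
    apPsi q (insert s(s, t) E) (fun A => if x ∈ A ∧ (y ∈ A ∨ z ∈ A ∨ w ∈ A) then 1 else 0) g ≤ 0 := by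
  rw [apPsi_andOr3_eq q hx hy hz hw]
  have h0 := apPsi_pivot_nonpos_of_isTTSP hq0 hq1 hE hst hx hgx hmono
  have h1 := apPsi_pivot_split_nonpos_of_isTTSP hq0 hq1 hE hst hx hz hw hxz hxw hzw hgx hgz hgw hmono
  have h2 := apPsi_pivot_split_nonpos_of_isTTSP hq0 hq1 hE hst hx hy hz hxy hxz hyz hgx hgy hgz hmono
  have h3 := apPsi_pivot_split_nonpos_of_isTTSP hq0 hq1 hE hst hx hy hw hxy hxw hyw hgx hgy hgw hmono
  have hS : ({y, z, w} : Finset (Sym2 V)) ⊆ insert s(s, t) E := by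
    intro e he
    simp only [Finset.mem_insert, Finset.mem_singleton] at he
    rcases he with rfl | rfl | rfl <;> assumption
  have h4 := apPsi_andSet_nonpos_of_isTTSP hq0 hq1 hE hst hS ⟨y, by simp⟩ (fun e he A => by
    simp only [Finset.mem_insert, Finset.mem_singleton] at he
    rcases he with rfl | rfl | rfl
    · exact hgy A
    · exact hgz A
    · exact hgw A) hmono
  have hfun : (fun X : Finset (Sym2 V) => if ({y, z, w} : Finset (Sym2 V)) ⊆ X then (1 : ℝ) else 0) =
      fun A => if y ∈ A ∧ z ∈ A ∧ w ∈ A then (1 : ℝ) else 0 := by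
    funext X; simp only [Finset.insert_subset_iff, Finset.singleton_subset_iff]
  rw [hfun] at h4
  linarith

end Threshold

end FK

end Summit.CriticalPhenomena.PercolationContinuityZ3.Theorems

end
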